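import Literature.Topology.FourManifolds.TautFoliationsPlaques
import HarnessLib

/-!
# Leaves of `C⁰` codimension-one foliations cross each flow box at countably many heights

Sibling of `TautFoliationsPlaques.lean` (plaques `plaque e t`, leaf heights
`F.leafHeights e x = H_e(L)` of the leaf `L = F.leaf x` of a `C⁰` codimension-one foliation
`F : Literature.Topology.FourManifolds.Foliation B M`). For a foliation of a *second countable* space `M` by
preconnected plaques this file proves, with complete proofs, the countability statement behind
"leaves have a countable basis" (Hector–Hirsch, *Introduction to the Geometry of Foliations,
Part A*, Ch. I 2.2.4, proof — chains of plaques from a countable family of distinguished open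
sets, "it follows by induction on `m` that `A_m` is countable" — and Ch. II 2.1.8, Exercise
(iv): "the leaves of a foliation are manifolds whose topologies have countable bases"):

* `Foliation.countable_image_of_eventually_eq` (**proved**): a function that is locally
  constant along a subset `S` of a second countable space takes countably many values on `S`
  (a countable dense subset of `S` already takes all the values).
* `Foliation.countable_image_height_plaque` (**proved**): a plaque of one flow box meets only
  countably many plaques of another (the transverse coordinate of `e'` is locally constant
  along `plaque e t`, `TautFoliationsPlaques.lean`).
* `Foliation.exists_countable_subatlas` (**proved**): countably many flow boxes of the atlas
  cover `M` (Lindelöf).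
* `Foliation.plaqueChain A x n` (**definition**) and `Foliation.leaf_eq_iUnion_plaqueChain`
  (**proved**): the points reached from `x` by chains of `n` plaques of flow boxes from `A`; for
  any subfamily `A` of the atlas covering `M`, these exhaust the leaf of `x` — **a covering
  subatlas has the same leaves** (a plaque of an arbitrary flow box is preconnected and is
  covered by the relatively open, pairwise disjoint traces of the `A`-chain classes).
* `Foliation.countable_leafHeights` (**proved**): **the set `H_e(L)` of heights at which a leaf
  crosses a flow box is countable** — by induction on the length of chains from a countable
  subatlas, each plaque contributing countably many heights in each box.

With `TautFoliationsPlaques.lean` (closed leaf ⇒ `H_e(L)` closed; accumulation is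
all-or-nothing along `L`) this yields in `TautFoliationsClosedLeaves.lean` that a closed leaf
is locally a single plaque (a nonempty countable closed subset of `ℝ` has an isolated point).

## References

* G. Hector, U. Hirsch, *Introduction to the Geometry of Foliations, Part A*, 2nd ed., Vieweg
  (1986), Ch. I 2.2.4; Ch. II 2.1.6, 2.1.8 (iv) [HectorHirsch1986].

## Design notes

* `plaqueChain` is indexed by an arbitrary family `A` of partial homeomorphisms so that it can
  be applied to a countable subatlas; only `A ⊆ F.atlas` and "the sources of `A` cover `M`" are
  ever assumed. Preconnectedness of the leaf model `B` (so that plaques are preconnected) is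
  needed exactly once, in `plaque_subset_iUnion_plaqueChain`.
-/
open scoped Topology
open Function Set Filter

namespace Literature.Topology.FourManifolds

namespace Foliation

variable {B : Type*} [TopologicalSpace B] {M : Type*} [TopologicalSpace M]
variable {e e' : OpenPartialHomeomorph M (B × ℝ)} {t : ℝ} {x y z : M}
variable (F : Foliation B M)

-- BODY
/-! ## Locally constant functions on subsets of second countable spaces -/

/-- **A function which is locally constant along a subset `S` of a second countable space takes
countably many values on `S`**: if every `z ∈ S` has a neighbourhood on whose trace on `S` the
function equals `f z`, then `f '' S` is countable — a countable dense subset `D` of the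
(separable) subspace `S` takes all the values, since the open set where `f = f z` meets `D`.
[folklore] -/
theorem countable_image_of_eventually_eq [SecondCountableTopology M] {β : Type*} {f : M → β}
    {S : Set M} (h : ∀ z ∈ S, ∀ᶠ w in 𝓝 z, w ∈ S → f w = f z) : (f '' S).Countable := by
  obtain ⟨D, hDc, hDd⟩ := TopologicalSpace.exists_countable_dense S
  refine ((hDc.image fun d : S ↦ f d).mono ?_)
  rintro _ ⟨z, hz, rfl⟩
  have hc : ContinuousAt (Subtype.val : S → M) ⟨z, hz⟩ := continuous_subtype_val.continuousAt
  have hev : ∀ᶠ w : S in 𝓝 ⟨z, hz⟩, f w = f z := by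
    filter_upwards [hc.eventually (h z hz)] with w hw
    exact hw w.2
  obtain ⟨W, hW, hWo, hzW⟩ := eventually_nhds_iff.1 hev
  obtain ⟨d, hdW, hdD⟩ := hDd.inter_open_nonempty W hWo ⟨_, hzW⟩
  exact ⟨d, hdD, hW d hdW⟩

/-- **A plaque of one flow box meets countably many plaques of another**: on
`plaque e t ∩ e'.source` the transverse coordinate of `e'` takes countably many values (it is
locally constant there, `eventually_height_eq_of_mem_plaque`). (Hector–Hirsch A, Ch. II
2.1.6 (iii): the intersection of two plaques is a union of plaques — countably many, each
plaque having a countable basis.) [folklore] -/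
theorem countable_image_height_plaque [SecondCountableTopology M] (he : e ∈ F.atlas)
    (he' : e' ∈ F.atlas) (t : ℝ) :
    ((fun z ↦ (e' z).2) '' (plaque e t ∩ e'.source)).Countable :=
  countable_image_of_eventually_eq fun _ hz ↦ by
    filter_upwards [F.eventually_height_eq_of_mem_plaque he he' hz.1 hz.2] with w hw hwS
    exact hw hwS.1 hwS.2

/-! ## Countable subatlases and plaque chains -/

/-- **Countable subatlas**: in a second countable space, countably many flow boxes of the
foliated atlas already cover (Lindelöf). [folklore] -/
theorem exists_countable_subatlas [SecondCountableTopology M] :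
    ∃ A ⊆ F.atlas, A.Countable ∧ ∀ x : M, ∃ e ∈ A, x ∈ e.source := by
  obtain ⟨T, hTc, hT⟩ := TopologicalSpace.isOpen_iUnion_countable
    (fun e : F.atlas ↦ (e : OpenPartialHomeomorph M (B × ℝ)).source) (fun e ↦ e.1.open_source)
  refine ⟨Subtype.val '' T, ?_, hTc.image _, fun x ↦ ?_⟩
  · rintro _ ⟨e, -, rfl⟩
    exact e.2
  · obtain ⟨e, he, hx⟩ := F.exists_mem_source x
    have hx' : x ∈ ⋃ i : F.atlas, (i : OpenPartialHomeomorph M (B × ℝ)).source :=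
      mem_iUnion.2 ⟨⟨e, he⟩, hx⟩
    rw [← hT] at hx'
    obtain ⟨i, hi, hxi⟩ := mem_iUnion₂.1 hx'
    exact ⟨i, ⟨i, hi, rfl⟩, hxi⟩

/-- **Plaque chains.** `plaqueChain A x n` is the set of points joined to `x` by a chain of `n`
plaques of flow boxes from the family `A`: `plaqueChain A x 0 = {x}`, and
`plaqueChain A x (n + 1)` is the union of the plaques of boxes `e ∈ A` through points of
`plaqueChain A x n` (the `m`-chains of Hector–Hirsch A, Ch. I 2.2.4, proof). [folklore] -/
def plaqueChain (A : Set (OpenPartialHomeomorph M (B × ℝ))) (x : M) : ℕ → Set M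
  | 0 => {x}
  | n + 1 => {z | ∃ e ∈ A, ∃ y ∈ plaqueChain A x n, y ∈ e.source ∧ z ∈ plaque e (e y).2}

variable {A : Set (OpenPartialHomeomorph M (B × ℝ))} {n : ℕ}

/-- Unfolding lemma: chains of length `0`. [folklore] -/
@[simp] theorem plaqueChain_zero (A : Set (OpenPartialHomeomorph M (B × ℝ))) (x : M) :
    plaqueChain A x 0 = {x} := rfl

/-- Unfolding lemma: chains of length `n + 1`. [folklore] -/
theorem mem_plaqueChain_succ_iff :
    z ∈ plaqueChain A x (n + 1) ↔
      ∃ e ∈ A, ∃ y ∈ plaqueChain A x n, y ∈ e.source ∧ z ∈ plaque e (e y).2 :=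
  Iff.rfl

/-- The base point is reached by the chain of length `0`. [folklore] -/
theorem mem_iUnion_plaqueChain_self (A : Set (OpenPartialHomeomorph M (B × ℝ))) (x : M) :
    x ∈ ⋃ n, plaqueChain A x n :=
  mem_iUnion.2 ⟨0, rfl⟩

/-- One more plaque of a box of `A` extends a chain. [folklore] -/
theorem mem_iUnion_plaqueChain_of_mem_plaque (he : e ∈ A) (hy : y ∈ ⋃ n, plaqueChain A x n)
    (hye : y ∈ e.source) (hz : z ∈ plaque e (e y).2) : z ∈ ⋃ n, plaqueChain A x n := by
  obtain ⟨n, hn⟩ := mem_iUnion.1 hy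
  exact mem_iUnion.2 ⟨n + 1, e, he, y, hn, hye, hz⟩

/-- Chains of plaques of the atlas stay in the leaf. [folklore] -/
theorem plaqueChain_subset_leaf (hA : A ⊆ F.atlas) : ∀ n, plaqueChain A x n ⊆ F.leaf x
  | 0 => by
    rintro z (rfl : z = x)
    exact F.mem_leaf_self z
  | n + 1 => by
    rintro z ⟨e, he, y, hy, hye, hz⟩
    exact F.plaque_subset_leaf_of_mem (hA he) (plaqueChain_subset_leaf hA n hy)
      (mem_plaque_self hye) hz

/-- **Chains from a countable subatlas cross each flow box at countably many heights**: by
induction on the length, `plaqueChain A x (n + 1) ∩ e'.source` is covered by the traces of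
the plaques `plaque e t`, `e ∈ A`, `t` a height of `plaqueChain A x n` in `e` — countably many
plaques, each contributing countably many `e'`-heights (`countable_image_height_plaque`;
Hector–Hirsch A, Ch. I 2.2.4, proof: "it follows by induction on `m` that `A_m` is
countable"). [folklore] -/
theorem countable_image_height_plaqueChain [SecondCountableTopology M] (hA : A ⊆ F.atlas)
    (hAc : A.Countable) :
    ∀ n, ∀ e' ∈ F.atlas, ((fun z ↦ (e' z).2) '' (plaqueChain A x n ∩ e'.source)).Countable
  | 0, e', _ => (((finite_singleton x).inter_of_left _).image _).countable
  | n + 1, e', he' => by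
    have IH := countable_image_height_plaqueChain hA hAc n
    have hsub : (fun z ↦ (e' z).2) '' (plaqueChain A x (n + 1) ∩ e'.source) ⊆
        ⋃ e ∈ A, ⋃ t ∈ (fun z ↦ (e z).2) '' (plaqueChain A x n ∩ e.source),
          (fun z ↦ (e' z).2) '' (plaque e t ∩ e'.source) := by
      rintro _ ⟨z, ⟨⟨e, he, y, hy, hye, hz⟩, hze'⟩, rfl⟩
      exact mem_iUnion₂.2 ⟨e, he, mem_iUnion₂.2 ⟨(e y).2, ⟨y, ⟨hy, hye⟩, rfl⟩, z, ⟨hz, hze'⟩, rfl⟩⟩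
    refine Countable.mono hsub (hAc.biUnion fun e he ↦ ?_)
    exact (IH e (hA he)).biUnion fun t _ ↦ F.countable_image_height_plaque (hA he) he' t

/-! ## A covering subatlas has the same leaves -/

/-- **A plaque met by the chains lies in their union.** Let `A ⊆ F.atlas` cover `M`, and let
the plaque `P = plaque e t` of an arbitrary flow box of `F` meet `S = ⋃ n, plaqueChain A x n`.
Near each `w ∈ P` the points of `P` lie on the `A`-plaque through `w`
(`eventually_height_eq_of_mem_plaque`), so both `{w | P ⊆ S near w}` and `{w | P ⊆ Sᶜ near w}`
are open, they cover `P` and are disjoint on `P`; as `P` is preconnected and meets the first,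
`P ⊆ S`. [folklore] -/
theorem plaque_subset_iUnion_plaqueChain [PreconnectedSpace B] (hA : A ⊆ F.atlas)
    (hAcov : ∀ x : M, ∃ e ∈ A, x ∈ e.source) (he : e ∈ F.atlas)
    (hy : y ∈ ⋃ n, plaqueChain A x n) (hyt : y ∈ plaque e t) :
    plaque e t ⊆ ⋃ n, plaqueChain A x n := by
  set S := ⋃ n, plaqueChain A x n with hS
  -- near each point `w` of the plaque, the plaque lies on the `A`-plaque through `w`
  have hloc : ∀ w ∈ plaque e t, ∃ e₀ ∈ A, w ∈ e₀.source ∧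
      ∀ᶠ v in 𝓝 w, v ∈ plaque e t → v ∈ plaque e₀ (e₀ w).2 := by
    intro w hw
    obtain ⟨e₀, he₀, hwe₀⟩ := hAcov w
    refine ⟨e₀, he₀, hwe₀, ?_⟩
    filter_upwards [F.eventually_height_eq_of_mem_plaque he (hA he₀) hw hwe₀,
      e₀.open_source.mem_nhds hwe₀] with v hv hve₀ hvP
    exact ⟨hve₀, hv hvP hve₀⟩
  -- the two open sets
  set U : Set M := {w | ∀ᶠ v in 𝓝 w, v ∈ plaque e t → v ∈ S} with hU
  set V : Set M := {w | ∀ᶠ v in 𝓝 w, v ∈ plaque e t → v ∉ S} with hV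
  have hUo : IsOpen U := isOpen_setOf_eventually_nhds
  have hVo : IsOpen V := isOpen_setOf_eventually_nhds
  have hcover : plaque e t ⊆ U ∪ V := by
    intro w hw
    obtain ⟨e₀, he₀, hwe₀, hev⟩ := hloc w hw
    by_cases hwS : w ∈ S
    · left
      filter_upwards [hev] with v hv hvP
      exact mem_iUnion_plaqueChain_of_mem_plaque he₀ hwS hwe₀ (hv hvP)
    · right
      filter_upwards [hev] with v hv hvP hvS
      exact hwS (mem_iUnion_plaqueChain_of_mem_plaque he₀ hvS (hv hvP).1 ⟨hwe₀, (hv hvP).2.symm⟩)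
  have hUV : ∀ w ∈ plaque e t, w ∈ U → w ∈ V → False := fun w hw hwU hwV ↦
    (Filter.Eventually.self_of_nhds hwV hw) (Filter.Eventually.self_of_nhds hwU hw)
  -- preconnectedness of the plaque
  intro z hz
  by_contra hzS
  have hzV : z ∈ V := by
    rcases hcover hz with hzU | hzV
    · exact absurd (Filter.Eventually.self_of_nhds hzU hz) hzS
    · exact hzV
  have hyU : y ∈ U := by
    rcases hcover hyt with hyU | hyV
    · exact hyU
    · exact absurd hy (Filter.Eventually.self_of_nhds hyV hyt)
  obtain ⟨w, hw, hwU, hwV⟩ :=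
    (F.isPreconnected_plaque he t) U V hUo hVo hcover ⟨y, hyt, hyU⟩ ⟨z, hz, hzV⟩
  exact hUV w hw hwU hwV

/-- **A covering subatlas has the same leaves**: for `A ⊆ F.atlas` whose boxes cover `M`, the
leaf of `x` is exhausted by the chains of `A`-plaques from `x` (induction along a chain of
plaques of the full atlas, each of which lies in `⋃ n, plaqueChain A x n` as soon as it meets
it, by `plaque_subset_iUnion_plaqueChain`). (Hector–Hirsch A, Ch. II 2.1.1 (iii), 2.1.6:
equivalent foliated atlases — in particular an atlas and its covering subfamilies — define the
same foliation, leaf topology and leaves.) [folklore] -/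
theorem leaf_eq_iUnion_plaqueChain [PreconnectedSpace B] (hA : A ⊆ F.atlas)
    (hAcov : ∀ x : M, ∃ e ∈ A, x ∈ e.source) (x : M) :
    F.leaf x = ⋃ n, plaqueChain A x n := by
  refine Subset.antisymm (fun y hy ↦ ?_) (iUnion_subset (F.plaqueChain_subset_leaf hA))
  suffices H : ∀ {a b : M}, Relation.EqvGen F.SamePlaque a b →
      (a ∈ ⋃ n, plaqueChain A x n ↔ b ∈ ⋃ n, plaqueChain A x n) from
    (H hy).1 (mem_iUnion_plaqueChain_self A x)
  intro a b hab
  induction hab with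
  | rel a b hab =>
    obtain ⟨e, he, hae, hbe, habe⟩ := hab
    exact ⟨fun ha ↦ F.plaque_subset_iUnion_plaqueChain hA hAcov he ha (mem_plaque_self hae)
        ⟨hbe, habe.symm⟩,
      fun hb ↦ F.plaque_subset_iUnion_plaqueChain hA hAcov he hb (mem_plaque_self hbe)
        ⟨hae, habe⟩⟩
  | refl a => exact Iff.rfl
  | symm a b _ ih => exact ih.symm
  | trans a b c _ _ ih₁ ih₂ => exact ih₁.trans ih₂

/-! ## Leaf heights are countable -/

/-- **A leaf crosses each flow box at countably many heights**: for a `C⁰` codimension-one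
foliation with preconnected leaf model of a second countable space, the set `H_e(L)` of heights
of the plaques of `e` contained in the leaf `L = F.leaf x` is countable (equivalently: `L` is a
countable union of plaques — Hector–Hirsch A, Ch. I 2.2.4 (proof) and Ch. II 2.1.8 (iv): leaves
have a countable basis). Proof: pass to a countable subatlas (`exists_countable_subatlas`,
`leaf_eq_iUnion_plaqueChain`) and count heights along chains
(`countable_image_height_plaqueChain`). [folklore] -/
theorem countable_leafHeights [SecondCountableTopology M] [PreconnectedSpace B] (he : e ∈ F.atlas)
    (x : M) : (F.leafHeights e x).Countable := by
  obtain ⟨A, hA, hAc, hAcov⟩ := F.exists_countable_subatlas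
  rw [F.leafHeights_eq_image, F.leaf_eq_iUnion_plaqueChain hA hAcov x, iUnion_inter,
    image_iUnion]
  exact countable_iUnion fun n ↦ F.countable_image_height_plaqueChain hA hAc n e he

end Foliation

end Literature.Topology.FourManifolds
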